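import Summits.NavierStokesRegularity.NavierStokesRegularity.Theses.PalasekTowerBreakdown
import Summits.NavierStokesRegularity.FluidComputer.PalasekTowerGermHostRateAmplifier

/-!
# `EpisodeBase` BY NAME for the NUMERIC designs «strict tiny carrier of scale `a ≤ 11/648` + ANY amplifier
# beyond a NUMERIC distance»

Cell `ns-blowup`, seat `ns-blowup-ecbridge-3` (g5); GROUP C «BRIDGE SUPPORT» of the route
`PalasekTowerBreakdown`, crux `EpisodeBase` (item stmt-NavierStokesRegularity-19179, R2 of record; line `slot`:
ONE stub `∃ U ρ c₄ (h : Germ.LevelZeroData U ρ) …, PushedLevelWitness (h.schedule c₄ …)`; holder's draft line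
`explicit`). Numeric twin of `PalasekTowerBreakdownEpisodeBaseAmplifier.lean` (g4) over
`FluidComputer/PalasekTowerGermHostRateAmplifier.lean` (GermHost XXV: carrier scale from the explicit strain point
`x₁ = (2/3)e₁`, p476398; amplifier budget from the quantitative rate `rate⋆ ≥ Y₀³/200000`, GermHost XXIV). LABEL:
E–C typing (KERNEL, proofs only, by name). WHAT THIS IS NOT: not Navier–Stokes evidence — the prescribed level-`0`
host of PRESCRIBED composite profiles and conditionals whose hypothesis is the OPEN episode of those designs;
nothing about any flow after `τ₀`, `RungG 1` or blow-up. HELPER for 19179 (`--supports`), closes nothing.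

For every numeric carrier scale `0 < a ≤ 11/648`, EVERY amplifier `W` (smooth, divergence free,
`tsupport W ⊆ B̄(0, R)`, `R ≥ 0`, speed `< Y₀` everywhere), every distance `d ≥ 1/N₀` and centre `c` with
`7 + d + R < ‖c‖` and the NUMERIC budget `(3/(2πd⁴)) Y₀ ∫‖W‖² < Y₀³/200000` (no `Classical.choose` constant):

* (the ∃-packaged prepared host of `strictTinyProfile a + W(· − c)` — pinned, rigid, quiet, radius `‖c‖ + R`,
  `τ₀ = 1`, PREPARED in its singleton class — has the same conclusion as g4's
  `palasekTowerBreakdown_exists_preparedHost_amplifier` and is therefore not restated here; its numeric form is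
  `Germ.hostPreparationD_amplifier_of_le` / `Germ.episodeBaseG_of_firstEpisodeD_amplifier_of_le` in FluidComputer);
* `palasekTowerBreakdown_episodeBase_of_numeric_levelWitness`: `EpisodeBase ⇐` ONE level witness of that germ
  schedule; `palasekTowerBreakdown_episodeBase_of_numeric_firstEpisodeD`: `EpisodeBase ⇐ FirstEpisodeD` of it;
* `palasekTowerBreakdown_exists_preparedHost_numericCarrier`: the same for the bare carrier `strictTinyProfile a`
  (radius `7`), whose slot rate is `≥ Y₀³/200000` (`Germ.anchor_strictTinyProfile_ge`).

References: S. Palasek, arXiv:2605.13827 §3.3, §4 (Step 2) [cite: Palasek2026ElementaryModel, §4];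
H. Sohr, *The Navier–Stokes Equations* (2001), Ch. V Thm. 1.5.1 [cite: Sohr2001, Ch. V Thm. 1.5.1].
-/

noncomputable section

-- `Summit.<Summit>.<Problem>` is the tree's mandated summit-side namespace (CONVENTIONS §2); for this
-- single-conjunct summit the two coincide, so the duplicate is deliberate.
set_option linter.dupNamespace false

namespace Summit.NavierStokesRegularity.NavierStokesRegularity.Theorems

open Set Function Metric MeasureTheory Real
open scoped ContDiff RealInnerProductSpace
open Summit.NavierStokesRegularity.FluidComputer.PalasekTowerClayBridge
open Summit.NavierStokesRegularity.FluidComputer.PalasekTowerClayBridge.Germ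
open Literature.Analysis.FluidPDE

section Amplifier

variable {a : ℝ} (ha : 0 < a) (h : a ≤ 11 / 648)
  {W : EuclideanSpace ℝ (Fin 3) → EuclideanSpace ℝ (Fin 3)} {R d : ℝ} {c : EuclideanSpace ℝ (Fin 3)}
  (hW : ContDiff ℝ ∞ W) (hdivW : VectorCalculus.IsDivFree W) (hWsupp : tsupport W ⊆ closedBall 0 R)
  (hWlt : ∀ x, ‖W x‖ < TowerRates.wide.Y 0) (hR : 0 ≤ R) (hdN : 1 / TowerRates.wide.N 0 ≤ d)
  (hc : 7 + d + R < ‖c‖)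
  (hbudget : 3 / (2 * π * d ^ 4) * TowerRates.wide.Y 0 * ∫ x, ‖W x‖ ^ 2 < TowerRates.wide.Y 0 ^ 3 / 200000)

include ha h hW hdivW hWsupp hWlt hR hdN hc hbudget

/-- **`EpisodeBase` from ONE LEVEL WITNESS of a numeric amplifier design** (no re-push).
[cite: Sohr2001, Ch. V Thm. 1.5.1] -/
theorem palasekTowerBreakdown_episodeBase_of_numeric_levelWitness {c₄ : ℝ} (hc₄ : 0 < c₄) (hc₄' : c₄ ≤ 1)
    (hLW : ((levelZeroData_strictTinyProfile_add_translate_of_le ha h hW hdivW hWsupp hWlt hR hdN hc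
      hbudget).schedule c₄ hc₄ hc₄').LevelWitness 1 0) :
    Summit.NavierStokesRegularity.NavierStokesRegularity.Theses.PalasekTowerBreakdown.EpisodeBase := by
  have hL := levelZeroData_strictTinyProfile_add_translate_of_le ha h hW hdivW hWsupp hWlt hR hdN hc hbudget
  exact hL.episodeBaseG_of_firstEpisodeD hc₄ hc₄'
    (firstEpisodeD_exact_of_levelWitness_self (hL.schedule_pins hc₄ hc₄') (hL.schedule_rigid hc₄ hc₄')
      (hL.schedule_quiet hc₄ hc₄') hLW)

/-- **`EpisodeBase` from the EPISODE of a numeric amplifier design.** [cite: Palasek2026ElementaryModel, §4] -/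
theorem palasekTowerBreakdown_episodeBase_of_numeric_firstEpisodeD {c₄ : ℝ} (hc₄ : 0 < c₄) (hc₄' : c₄ ≤ 1)
    (hF : FirstEpisodeD (HostClass.exact
      ((levelZeroData_strictTinyProfile_add_translate_of_le ha h hW hdivW hWsupp hWlt hR hdN hc
        hbudget).schedule c₄ hc₄ hc₄'))) :
    Summit.NavierStokesRegularity.NavierStokesRegularity.Theses.PalasekTowerBreakdown.EpisodeBase :=
  (levelZeroData_strictTinyProfile_add_translate_of_le ha h hW hdivW hWsupp hWlt hR hdN hc
    hbudget).episodeBaseG_of_firstEpisodeD hc₄ hc₄' hF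

end Amplifier

/-- **A PREPARED HOST FOR EVERY NUMERIC CARRIER SCALE** (∃-packaged, no amplifier): for `0 < a ≤ 11/648` and
every push `c₄ ∈ (0, 1]`, the germ schedule of `strictTinyProfile a` — pinned, rigid, quiet, radius `7`, `τ₀ = 1` —
is PREPARED in its singleton class, its profile passes the anchor test with the NUMERIC rate `≥ Y₀³/200000` on its
argmax, and its episode gives the crux. [cite: Palasek2026ElementaryModel, §4] -/
theorem palasekTowerBreakdown_exists_preparedHost_numericCarrier {a : ℝ} (ha : 0 < a) (h : a ≤ 11 / 648)
    {c₄ : ℝ} (hc₄ : 0 < c₄) (hc₄' : c₄ ≤ 1) :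
    ∃ S : Schedule TowerRates.wide, S.Pins 8 (6 / 5) ∧ S.Rigid ∧ S.Quiet ∧ S.radius = 7 ∧ S.τ 0 = 1 ∧
      HostPreparationD (HostClass.exact S) ∧
      (∀ x, ‖strictTinyProfile a x‖ = TowerRates.wide.Y 0 →
        TowerRates.wide.Y 0 ^ 3 / 200000 ≤ ⟪strictTinyProfile a x, accel 1 (strictTinyProfile a) x⟫) ∧
        (FirstEpisodeD (HostClass.exact S) →
          Summit.NavierStokesRegularity.NavierStokesRegularity.Theses.PalasekTowerBreakdown.EpisodeBase) := by
  have hL := levelZeroData_strictTinyProfile_of_le ha h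
  exact ⟨hL.schedule c₄ hc₄ hc₄', hL.schedule_pins hc₄ hc₄', hL.schedule_rigid hc₄ hc₄',
    hL.schedule_quiet hc₄ hc₄', hL.schedule_radius hc₄ hc₄', hL.schedule_τ_zero hc₄ hc₄',
    hL.hostPreparationD_exact hc₄ hc₄',
    fun x hx => anchor_strictTinyProfile_ge ha (h.trans (by norm_num)) x hx,
    fun hF => hL.episodeBaseG_of_firstEpisodeD hc₄ hc₄' hF⟩

end Summit.NavierStokesRegularity.NavierStokesRegularity.Theorems

end
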